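import Summits.KontsevichZagierPeriods.KontsevichZagierPeriods.Theorems.HurwitzMicroSectorsHurwitzSectorComplementStubOkadaCharacters
import Summits.KontsevichZagierPeriods.KontsevichZagierPeriods.Theorems.HurwitzMicroSectorsHurwitzSectorComplementStubOkadaCyclotomic
import Summits.KontsevichZagierPeriods.KontsevichZagierPeriods.Theorems.HurwitzMicroSectorsHurwitzSectorComplementStubOkadaFourier

/-!
# Okada's theorem (Hurwitz form) from a trigonometric evaluation of the symmetric kernel sums

`okada_of_trig`: if for `0 < a < L` the symmetric kernel sums
`K(w,L,a) = Σ_k (Lk+a)^{-w} + (−1)^w Σ_k (Lk+L−a)^{-w}` admit ANY evaluation of the shape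
`K(w,L,a) = C · Σ_{j<L} B_j · trig_w(2π j a/L)` with RATIONAL weights `B_j`, a constant `C ≠ 0` and
`trig_w = cos` (`w` even) / `sin` (`w` odd) — classically `B_j = B_w(j/L)` (Bernoulli polynomial) and
`C ∈ ℚ^× π^w / L` by the Fourier expansion of the periodic Bernoulli functions — then the `K(w,L,a)`,
`0 < a < L/2`, `gcd(a,L) = 1`, are `ℚ`-linearly independent (`w ≥ 2`, `L ≥ 3`).
Proof: a rational relation becomes the vanishing at `ζ_L` of a rational polynomial (parity kills the
other trigonometric part), hence vanishes at every `ζ_L^t` (step G), i.e. all unit-twists of the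
relation hold; read back as Dirichlet-type series these say `Σ_n Λ(t⁻¹n) n^{-w} = 0` for all units `t`,
and step (B) (characters, `L(χ,w) ≠ 0`) forces `Λ = 0`.
[cite: Okada1981, Theorem] [cite: GunMurtyRath2011, Thm 1]
-/

noncomputable section

open Complex
open scoped BigOperators

namespace Summit.KontsevichZagierPeriods.Theorems.HurwitzMicroSectorsHurwitzSectorComplement.Okada

variable {L : ℕ} [NeZero L]

/-- The symmetric kernel sum at a unit residue `u` is `Z(u) + (−1)^w Z(−u)`. [folklore] -/
theorem kernel_eq_indicator (w : ℕ) (hL : 1 < L) (u : ZMod L) (hu : IsUnit u) :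
    (∑' k : ℕ, 1 / ((L : ℝ) * k + u.val) ^ w) +
        (-1 : ℝ) ^ w * (∑' k : ℕ, 1 / ((L : ℝ) * k + ((L : ℝ) - u.val)) ^ w) =
      (∑' n : ℕ, (if (n : ZMod L) = u then (1 : ℝ) else 0) / (n : ℝ) ^ w) +
        (-1 : ℝ) ^ w * (∑' n : ℕ, (if (n : ZMod L) = -u then (1 : ℝ) else 0) / (n : ℝ) ^ w) := by
  have hu0 : u ≠ 0 := by
    rintro rfl
    have h01 : (0 : ZMod L) = 1 := isUnit_zero_iff.mp hu
    haveI : Fact (1 < L) := ⟨hL⟩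
    exact zero_ne_one h01
  have hpos : 0 < u.val := Nat.pos_of_ne_zero ((ZMod.val_ne_zero u).mpr hu0)
  rw [tsum_shift_eq_tsum_indicator w (ZMod.val_lt u),
    tsum_shift_neg_eq_tsum_indicator w hpos (ZMod.val_lt u), ZMod.natCast_zmod_val]

/-- **The cyclotomic double sum of a parity-`(−1)^w` coefficient function supported on units is, up to
the constant `C` and the unit `1`/`i`, twice the Dirichlet-type series `Σ_n Λ(n) n^{-w}`.** [folklore] -/
theorem const_mul_doubleSum_eq (w : ℕ) (hw : 2 ≤ w) (hL : 1 < L) (B : ℕ → ℚ) (C : ℝ)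
    (htrig : ∀ a : ℕ, 0 < a → a < L →
      (∑' k : ℕ, 1 / ((L : ℝ) * k + a) ^ w) + (-1 : ℝ) ^ w * (∑' k : ℕ, 1 / ((L : ℝ) * k + ((L : ℝ) - a)) ^ w)
        = C * ∑ j ∈ Finset.range L, (B j : ℝ) *
          (if Even w then Real.cos (2 * Real.pi * (j * a : ℕ) / L) else Real.sin (2 * Real.pi * (j * a : ℕ) / L)))
    (Λ : ZMod L → ℚ) (hpar : ∀ u, Λ (-u) = (-1) ^ w * Λ u) (hunit : ∀ u, ¬ IsUnit u → Λ u = 0) :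
    (C : ℂ) * ∑ j ∈ Finset.range L, ∑ u : ZMod L,
        ((Λ u * B j : ℚ) : ℂ) * Complex.exp (2 * Real.pi * I / L) ^ (j * u.val) =
      (if Even w then (1 : ℂ) else I) *
        (((2 : ℝ) * ∑' n : ℕ, (Λ (n : ZMod L) : ℝ) / (n : ℝ) ^ w : ℝ) : ℂ) := by
  -- abbreviations
  set Z : ZMod L → ℝ := fun u => ∑' n : ℕ, (if (n : ZMod L) = u then (1 : ℝ) else 0) / (n : ℝ) ^ w
    with hZ
  set S : ℝ := ∑' n : ℕ, (Λ (n : ZMod L) : ℝ) / (n : ℝ) ^ w with hS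
  have hε2 : ((-1 : ℝ) ^ w) * ((-1 : ℝ) ^ w) = 1 := by
    rw [← mul_pow, neg_one_mul, neg_neg, one_pow]
  -- S = Σ_u Λ u Z u
  have h1 : S = ∑ u : ZMod L, (Λ u : ℝ) * Z u := by
    rw [hS, hZ]
    exact (sum_mul_tsum_indicator w hw (fun u => (Λ u : ℝ))).symm
  -- 2 S = Σ_u Λ u (Z u + ε Z (−u))
  have h2 : 2 * S = ∑ u : ZMod L, (Λ u : ℝ) * (Z u + (-1 : ℝ) ^ w * Z (-u)) := by
    have hre : ∑ u : ZMod L, (Λ u : ℝ) * Z (-u) = (-1 : ℝ) ^ w * S := by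
      rw [h1, Finset.mul_sum]
      refine (Fintype.sum_equiv (Equiv.neg (ZMod L)) _ _ fun u => ?_)
      simp only [Equiv.neg_apply]
      rw [show Λ u = Λ (-(-u)) by rw [neg_neg], hpar (-u)]
      push_cast
      ring
    simp only [mul_add, Finset.sum_add_distrib, ← h1]
    rw [show ∑ u : ZMod L, (Λ u : ℝ) * ((-1 : ℝ) ^ w * Z (-u)) =
      (-1 : ℝ) ^ w * ∑ u : ZMod L, (Λ u : ℝ) * Z (-u) by
      rw [Finset.mul_sum]; exact Finset.sum_congr rfl fun u _ => by ring, hre, ← mul_assoc, hε2]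
    ring
  -- on units the bracket is the kernel sum, hence `C · Σ_j B_j trig`
  have h3 : ∀ u : ZMod L, (Λ u : ℝ) * (Z u + (-1 : ℝ) ^ w * Z (-u)) =
      (Λ u : ℝ) * (C * ∑ j ∈ Finset.range L, (B j : ℝ) *
        (if Even w then Real.cos (2 * Real.pi * (j * u.val : ℕ) / L)
          else Real.sin (2 * Real.pi * (j * u.val : ℕ) / L))) := by
    intro u
    by_cases hu : IsUnit u
    · have hu0 : u ≠ 0 := by
        rintro rfl
        haveI : Fact (1 < L) := ⟨hL⟩
        exact zero_ne_one (isUnit_zero_iff.mp hu)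
      have hpos : 0 < u.val := Nat.pos_of_ne_zero ((ZMod.val_ne_zero u).mpr hu0)
      rw [← htrig u.val hpos (ZMod.val_lt u), kernel_eq_indicator w hL u hu]
    · rw [hunit u hu]
      push_cast
      ring
  have h4 : 2 * S = C * ∑ j ∈ Finset.range L, ∑ u : ZMod L, (Λ u * B j : ℝ) *
      (if Even w then Real.cos (2 * Real.pi * (j * u.val : ℕ) / L)
        else Real.sin (2 * Real.pi * (j * u.val : ℕ) / L)) := by
    calc 2 * S = ∑ u : ZMod L, (Λ u : ℝ) * (C * ∑ j ∈ Finset.range L, (B j : ℝ) *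
          (if Even w then Real.cos (2 * Real.pi * (j * u.val : ℕ) / L)
            else Real.sin (2 * Real.pi * (j * u.val : ℕ) / L))) := by
          rw [h2]; exact Finset.sum_congr rfl fun u _ => h3 u
      _ = ∑ u : ZMod L, ∑ j ∈ Finset.range L, C * ((Λ u * B j : ℝ) *
          (if Even w then Real.cos (2 * Real.pi * (j * u.val : ℕ) / L)
            else Real.sin (2 * Real.pi * (j * u.val : ℕ) / L))) := by
          refine Finset.sum_congr rfl fun u _ => ?_
          rw [Finset.mul_sum, Finset.mul_sum]
          refine Finset.sum_congr rfl fun j _ => ?_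
          ring
      _ = ∑ j ∈ Finset.range L, ∑ u : ZMod L, C * ((Λ u * B j : ℝ) *
          (if Even w then Real.cos (2 * Real.pi * (j * u.val : ℕ) / L)
            else Real.sin (2 * Real.pi * (j * u.val : ℕ) / L))) := Finset.sum_comm
      _ = C * ∑ j ∈ Finset.range L, ∑ u : ZMod L, (Λ u * B j : ℝ) *
          (if Even w then Real.cos (2 * Real.pi * (j * u.val : ℕ) / L)
            else Real.sin (2 * Real.pi * (j * u.val : ℕ) / L)) := by
          rw [Finset.mul_sum]
          refine Finset.sum_congr rfl fun j _ => ?_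
          rw [Finset.mul_sum]
  -- read off real and imaginary parts
  set E : ℂ := ∑ j ∈ Finset.range L, ∑ u : ZMod L,
      ((Λ u * B j : ℚ) : ℂ) * Complex.exp (2 * Real.pi * I / L) ^ (j * u.val) with hE
  have hEre := re_doubleSum Λ B (Finset.range L)
  have hEim := im_doubleSum Λ B (Finset.range L)
  rcases Nat.even_or_odd w with heven | hodd
  · have hε : ((-1 : ℚ) ^ w) = 1 := heven.neg_one_pow
    have hpar' : ∀ u, Λ (-u) = Λ u := fun u => by rw [hpar u, hε, one_mul]
    have him0 : E.im = 0 := by rw [hE, hEim]; exact sin_doubleSum_eq_zero Λ hpar' B _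
    simp only [heven, if_true] at h4 ⊢
    have hE' : E = ((E.re : ℝ) : ℂ) := Complex.ext (by simp) (by simp [him0])
    rw [hE', hEre, one_mul, ← Complex.ofReal_mul, ← h4]
  · have hne : ¬ Even w := Nat.not_even_iff_odd.mpr hodd
    have hε : ((-1 : ℚ) ^ w) = -1 := hodd.neg_one_pow
    have hpar' : ∀ u, Λ (-u) = -Λ u := fun u => by rw [hpar u, hε, neg_one_mul]
    have hre0 : E.re = 0 := by rw [hE, hEre]; exact cos_doubleSum_eq_zero Λ hpar' B _
    simp only [hne, if_false] at h4 ⊢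
    have hE' : E = I * ((E.im : ℝ) : ℂ) := Complex.ext (by simp [hre0]) (by simp)
    rw [hE', hEim, mul_left_comm, ← Complex.ofReal_mul, ← h4]

/-- Corollary: under the trigonometric evaluation (`C ≠ 0`), the Dirichlet-type series of a
parity-`(−1)^w`, unit-supported, rational coefficient function vanishes iff its cyclotomic double sum
vanishes. [folklore] -/
theorem tsum_eq_zero_iff_doubleSum_eq_zero (w : ℕ) (hw : 2 ≤ w) (hL : 1 < L) (B : ℕ → ℚ) (C : ℝ)
    (hC : C ≠ 0)
    (htrig : ∀ a : ℕ, 0 < a → a < L →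
      (∑' k : ℕ, 1 / ((L : ℝ) * k + a) ^ w) + (-1 : ℝ) ^ w * (∑' k : ℕ, 1 / ((L : ℝ) * k + ((L : ℝ) - a)) ^ w)
        = C * ∑ j ∈ Finset.range L, (B j : ℝ) *
          (if Even w then Real.cos (2 * Real.pi * (j * a : ℕ) / L) else Real.sin (2 * Real.pi * (j * a : ℕ) / L)))
    (Λ : ZMod L → ℚ) (hpar : ∀ u, Λ (-u) = (-1) ^ w * Λ u) (hunit : ∀ u, ¬ IsUnit u → Λ u = 0) :
    (∑' n : ℕ, (Λ (n : ZMod L) : ℝ) / (n : ℝ) ^ w) = 0 ↔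
      ∑ j ∈ Finset.range L, ∑ u : ZMod L,
        ((Λ u * B j : ℚ) : ℂ) * Complex.exp (2 * Real.pi * I / L) ^ (j * u.val) = 0 := by
  have h := const_mul_doubleSum_eq w hw hL B C htrig Λ hpar hunit
  have hpre : (if Even w then (1 : ℂ) else I) ≠ 0 := by split_ifs <;> simp [I_ne_zero]
  constructor
  · intro h0
    rw [h0, mul_zero, Complex.ofReal_zero, mul_zero] at h
    exact (mul_eq_zero.mp h).resolve_left (by exact_mod_cast hC)
  · intro h0
    rw [h0, mul_zero] at h
    have h2 := (mul_eq_zero.mp h.symm).resolve_left hpre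
    have h3 : (2 : ℝ) * ∑' n : ℕ, (Λ (n : ZMod L) : ℝ) / (n : ℝ) ^ w = 0 := by exact_mod_cast h2
    linarith

/-- **Okada's theorem (Hurwitz form) from a trigonometric evaluation.** See the module docstring.
[cite: Okada1981, Theorem] [cite: GunMurtyRath2011, Thm 1] -/
theorem okada_of_trig' (w L : ℕ) (hw : 2 ≤ w) (hL : 3 ≤ L) (B : ℕ → ℚ) (C : ℝ) (hC : C ≠ 0)
    (htrig : ∀ a : ℕ, 0 < a → a < L →
      (∑' k : ℕ, 1 / ((L : ℝ) * k + a) ^ w) + (-1 : ℝ) ^ w * (∑' k : ℕ, 1 / ((L : ℝ) * k + ((L : ℝ) - a)) ^ w)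
        = C * ∑ j ∈ Finset.range L, (B j : ℝ) *
          (if Even w then Real.cos (2 * Real.pi * (j * a : ℕ) / L) else Real.sin (2 * Real.pi * (j * a : ℕ) / L))) :
    LinearIndependent ℚ (fun a : {a : ℕ // a ∈ (Finset.range L).filter (fun a => 2 * a < L ∧ Nat.Coprime a L)} =>
      (∑' k : ℕ, 1 / ((L : ℝ) * k + a.1) ^ w) + (-1 : ℝ) ^ w * (∑' k : ℕ, 1 / ((L : ℝ) * k + ((L : ℝ) - a.1)) ^ w)) := by
  haveI : NeZero L := ⟨by omega⟩
  have hL1 : 1 < L := by omega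
  set T := (Finset.range L).filter (fun a => 2 * a < L ∧ Nat.Coprime a L) with hTdef
  rw [Fintype.linearIndependent_iff]
  intro g hg
  -- facts about the index set `T`
  have hT : ∀ a : ℕ, a ∈ T → 0 < a ∧ a < L ∧ 2 * a < L ∧ Nat.Coprime a L := by
    intro a ha
    simp only [hTdef, Finset.mem_filter, Finset.mem_range] at ha
    refine ⟨Nat.pos_of_ne_zero ?_, ha.1, ha.2.1, ha.2.2⟩
    rintro rfl
    have := ha.2.2
    rw [Nat.coprime_zero_left] at this
    omega
  -- two elements of `T` are never negatives of each other mod `L`, and `a ↦ (a : ZMod L)` is injective on `T`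
  have hne : ∀ a b : ℕ, a ∈ T → b ∈ T → (a : ZMod L) ≠ -(b : ZMod L) := by
    intro a b ha hb h
    obtain ⟨ha0, haL, ha2, -⟩ := hT a ha
    obtain ⟨hb0, hbL, hb2, -⟩ := hT b hb
    have h1 : ((a + b : ℕ) : ZMod L) = 0 := by push_cast; rw [h, neg_add_cancel]
    rw [ZMod.natCast_eq_zero_iff] at h1
    obtain ⟨c, hc⟩ := h1
    rcases c with _ | c
    · omega
    · have : L ≤ a + b := by rw [hc]; exact Nat.le_mul_of_pos_right L (Nat.succ_pos c)
      omega
  have hinj : ∀ a b : ℕ, a ∈ T → b ∈ T → (a : ZMod L) = (b : ZMod L) → a = b := by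
    intro a b ha hb h
    obtain ⟨-, haL, -, -⟩ := hT a ha
    obtain ⟨-, hbL, -, -⟩ := hT b hb
    rw [ZMod.natCast_eq_natCast_iff', Nat.mod_eq_of_lt haL, Nat.mod_eq_of_lt hbL] at h
    exact h
  -- the coefficient function `Λ = Σ_a g_a (δ_a + (−1)^w δ_{−a})`
  set Λ : ZMod L → ℚ := fun u => ∑ a : {a : ℕ // a ∈ T},
      g a * ((if u = (a.1 : ZMod L) then 1 else 0) + (-1) ^ w * (if u = -(a.1 : ZMod L) then 1 else 0))
    with hΛdef
  have hε2 : ((-1 : ℚ) ^ w) * (-1) ^ w = 1 := by rw [← mul_pow, neg_one_mul, neg_neg, one_pow]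
  -- `Λ` restricted to `T` is `g`
  have hΛT : ∀ b : {a : ℕ // a ∈ T}, Λ (b.1 : ZMod L) = g b := by
    intro b
    rw [hΛdef]
    simp only
    rw [Finset.sum_eq_single b]
    · rw [if_pos rfl, if_neg (hne b.1 b.1 b.2 b.2)]; ring
    · intro a _ hab
      have h1 : (b.1 : ZMod L) ≠ (a.1 : ZMod L) := fun h =>
        hab (Subtype.ext (hinj _ _ a.2 b.2 h.symm))
      rw [if_neg h1, if_neg (hne b.1 a.1 b.2 a.2)]; ring
    · intro hb; exact absurd (Finset.mem_univ b) hb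
  -- parity
  have hpar : ∀ u, Λ (-u) = (-1) ^ w * Λ u := by
    intro u
    rw [hΛdef]
    simp only [Finset.mul_sum]
    refine Finset.sum_congr rfl fun a _ => ?_
    have e1 : (-u = (a.1 : ZMod L)) ↔ (u = -(a.1 : ZMod L)) := neg_eq_iff_eq_neg
    have e2 : (-u = -(a.1 : ZMod L)) ↔ (u = (a.1 : ZMod L)) := neg_inj
    simp only [e1, e2]
    linear_combination (-(g a * (if u = -(a.1 : ZMod L) then (1 : ℚ) else 0))) * hε2
  -- support on units
  have hunit : ∀ u, ¬ IsUnit u → Λ u = 0 := by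
    intro u hu
    rw [hΛdef]
    refine Finset.sum_eq_zero fun a _ => ?_
    obtain ⟨-, -, -, hcop⟩ := hT a.1 a.2
    have hua : IsUnit ((a.1 : ℕ) : ZMod L) := (ZMod.isUnit_iff_coprime a.1 L).mpr hcop
    rw [if_neg (fun h => hu (by rw [h]; exact hua)), if_neg (fun h => hu (by rw [h]; exact hua.neg))]
    ring
  -- the given relation says `Σ_n Λ(n) n^{-w} = 0`
  have hS : ∑' n : ℕ, (Λ (n : ZMod L) : ℝ) / (n : ℝ) ^ w = 0 := by
    rw [← sum_mul_tsum_indicator w hw (fun u => (Λ u : ℝ))]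
    set Z : ZMod L → ℝ := fun u => ∑' n : ℕ, (if (n : ZMod L) = u then (1 : ℝ) else 0) / (n : ℝ) ^ w
      with hZ
    show ∑ u : ZMod L, (Λ u : ℝ) * Z u = 0
    have step : ∀ u : ZMod L, (Λ u : ℝ) * Z u = ∑ a : {a : ℕ // a ∈ T}, (g a : ℝ) *
        (((if u = (a.1 : ZMod L) then (1 : ℝ) else 0) * Z u) +
          (-1 : ℝ) ^ w * ((if u = -(a.1 : ZMod L) then (1 : ℝ) else 0) * Z u)) := by
      intro u
      rw [hΛdef]
      push_cast
      simp only [apply_ite ((↑) : ℚ → ℝ), Rat.cast_one, Rat.cast_zero, Finset.sum_mul]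
      refine Finset.sum_congr rfl fun a _ => ?_
      ring
    have inner : ∀ a : {a : ℕ // a ∈ T}, ∑ u : ZMod L, (g a : ℝ) *
        (((if u = (a.1 : ZMod L) then (1 : ℝ) else 0) * Z u) +
          (-1 : ℝ) ^ w * ((if u = -(a.1 : ZMod L) then (1 : ℝ) else 0) * Z u)) =
        (g a : ℝ) * (Z (a.1 : ZMod L) + (-1 : ℝ) ^ w * Z (-(a.1 : ZMod L))) := by
      intro a
      rw [← Finset.mul_sum, Finset.sum_add_distrib, ← Finset.mul_sum]
      simp only [ite_mul, one_mul, zero_mul, Finset.sum_ite_eq', Finset.mem_univ, if_true]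
    rw [Finset.sum_congr rfl fun u _ => step u, Finset.sum_comm,
      Finset.sum_congr rfl fun a _ => inner a]
    convert hg using 1
    refine Finset.sum_congr rfl fun a _ => ?_
    obtain ⟨ha0, haL, -, -⟩ := hT a.1 a.2
    rw [Rat.smul_def, tsum_shift_eq_tsum_indicator w haL, tsum_shift_neg_eq_tsum_indicator w ha0 haL]
  -- the cyclotomic double sum vanishes, hence so do all its twists, hence all twisted series
  have hEΛ := (tsum_eq_zero_iff_doubleSum_eq_zero w hw hL1 B C hC htrig Λ hpar hunit).mp hS
  have hζ : IsPrimitiveRoot (Complex.exp (2 * Real.pi * I / L)) L :=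
    Complex.isPrimitiveRoot_exp L (NeZero.ne L)
  have hall : ∀ x : ZMod L, ((Λ x : ℚ) : ℂ) = 0 := by
    refine apply_eq_zero_of_forall_LSeries_twist_eq_zero w hw (fun u => ((Λ u : ℚ) : ℂ))
      (fun u hu => by simp [hunit u hu]) (fun t => ?_)
    have hpar_t : ∀ u, Λ (((t⁻¹ : (ZMod L)ˣ) : ZMod L) * -u) =
        (-1) ^ w * Λ (((t⁻¹ : (ZMod L)ˣ) : ZMod L) * u) := fun u => by rw [mul_neg, hpar]
    have hunit_t : ∀ u, ¬ IsUnit u → Λ (((t⁻¹ : (ZMod L)ˣ) : ZMod L) * u) = 0 := fun u hu => by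
      refine hunit _ fun h => hu ?_
      have : u = (t : ZMod L) * (((t⁻¹ : (ZMod L)ˣ) : ZMod L) * u) := by
        rw [← mul_assoc, Units.mul_inv, one_mul]
      rw [this]
      exact (Units.isUnit t).mul h
    have hEt := twist_doubleSum_eq_zero hζ Λ B hEΛ t
    have hSt := (tsum_eq_zero_iff_doubleSum_eq_zero w hw hL1 B C hC htrig
      (fun u => Λ (((t⁻¹ : (ZMod L)ˣ) : ZMod L) * u)) hpar_t hunit_t).mpr hEt
    have hbridge := LSeries_ratCast_natCast w (by omega)
      (fun m : ℕ => Λ (((t⁻¹ : (ZMod L)ˣ) : ZMod L) * (m : ZMod L)))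
    rw [hbridge, hSt, Complex.ofReal_zero]
  intro b
  have := hall (b.1 : ZMod L)
  rw [hΛT] at this
  exact_mod_cast this

/-- **Okada's theorem from a trigonometric evaluation, registered form** (explicit `∀`-binders; see
`okada_of_trig'`). [cite: Okada1981, Theorem] [cite: GunMurtyRath2011, Thm 1] -/
theorem okada_of_trig : ∀ (w L : ℕ), 2 ≤ w → 3 ≤ L → ∀ (B : ℕ → ℚ) (C : ℝ), C ≠ 0 → (∀ a : ℕ, 0 < a → a < L → (∑' k : ℕ, 1 / ((L : ℝ) * k + a) ^ w) + (-1 : ℝ) ^ w * (∑' k : ℕ, 1 / ((L : ℝ) * k + ((L : ℝ) - a)) ^ w) = C * ∑ j ∈ Finset.range L, (B j : ℝ) * (if Even w then Real.cos (2 * Real.pi * (j * a : ℕ) / L) else Real.sin (2 * Real.pi * (j * a : ℕ) / L))) → LinearIndependent ℚ (fun a : {a : ℕ // a ∈ (Finset.range L).filter (fun a => 2 * a < L ∧ Nat.Coprime a L)} => (∑' k : ℕ, 1 / ((L : ℝ) * k + a.1) ^ w) + (-1 : ℝ) ^ w * (∑' k : ℕ, 1 / ((L : ℝ) * k + ((L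 : ℝ) - a.1)) ^ w)) :=
  fun w L hw hL B C hC htrig => okada_of_trig' w L hw hL B C hC htrig

end Summit.KontsevichZagierPeriods.Theorems.HurwitzMicroSectorsHurwitzSectorComplement.Okada

end
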